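import Summits.BirchSwinnertonDyer.BirchSwinnertonDyer.Theses.InertBadSignedBranches

/-!
# K8-inert child `InertBadAtThreeIstarZero` (item 19656): the route's TYPED valuation law is VACUOUS at `p = 3`

Seat `bsd-cm-k8i-c41` (gen 4), `--supports stmt-BirchSwinnertonDyer-19656`. A typed obstruction, recorded
in the kernel so that no planner files "the `p = 3` instance of `CccOneLawOnTypeIstarZero`" as the missing
law at `3`: the cell's typed law `Additive.QuadraticBranchMinusLeadingValuationAt W p δ` (x1b; the body of
the K8 crux `CccOneLawOnTypeIstarZero` through `QuadraticBranchPAdicGrossZagierValuationAt W p :=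
QuadraticBranchMinusLeadingValuationAt W p 0`) carries the guard `5 ≤ p →` INSIDE its binder list, so at
every prime `p < 5` it holds trivially, for every curve and every offset `δ`. Consequently the text of the
`p ≥ 5` crux read at `p = 3` is a theorem with no content, whereas the child 19656 is `BSD₃` on the type
(`InertBadAtThreeEveryCurve.inertBadAtThreeIstarZero_iff_lowerHalfOnType_three_of_maninOptimal`): the
«law at 3» the child needs is the δ-free PAIR form (displayed hypothesis `hlaw₃` of
`inertBadSignedBranches_inertBadAtThreeIstarZero_of_pairLawAtThree_of_verbatimReadingsAtThree`, p418040)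
or the η-branch Gross–Zagier VALUE form, never this typed `Prop`. Theorems only; nothing asserted about
`BSD`. [folklore]
-/

set_option autoImplicit false
set_option linter.dupNamespace false

namespace Summit.BirchSwinnertonDyer.BirchSwinnertonDyer.Theorems.InertBadAtThreeTypedLaw

open Summit.BirchSwinnertonDyer.Rank1Residual Summit.BirchSwinnertonDyer.Rank1Residual.Additive

/-- **The typed signed-branch valuation law is vacuous below 5.** For `p < 5` the internal guard
`5 ≤ p →` of `QuadraticBranchMinusLeadingValuationAt W p δ` can never be met, so the `Prop` holds for
every globally minimal elliptic `W` and every offset `δ`. [folklore] -/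
theorem quadraticBranchMinusLeadingValuationAt_of_lt_five (W : WeierstrassCurve ℚ) [W.IsElliptic]
    [W.IsGloballyMinimal] (p : ℕ) [Fact p.Prime] (hp : p < 5) (δ : ℤ) :
    QuadraticBranchMinusLeadingValuationAt W p δ := by
  intro V _ _ C N _ f h5
  exact absurd h5 (by omega)

/-- **In particular the typed C-cc-1 law holds trivially at `p = 3`** (`δ = 0`). [folklore] -/
theorem quadraticBranchPAdicGrossZagierValuationAt_three (W : WeierstrassCurve ℚ) [W.IsElliptic]
    [W.IsGloballyMinimal] [Fact (Nat.Prime 3)] :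
    QuadraticBranchPAdicGrossZagierValuationAt W 3 :=
  quadraticBranchMinusLeadingValuationAt_of_lt_five W 3 (by norm_num) 0

/-- **The `p ≥ 5` crux text of `CccOneLawOnTypeIstarZero` READ AT `p = 3` is a contentless theorem**:
for every `W` of signed local type `(3, I₀*)` and analytic rank one the typed law at `3` holds — by
vacuity, not by arithmetic. Hence item 19656 (`= BSD₃` on the type modulo published facts) is NOT the
`p = 3` instance of the typed crux, and a «law at 3» item must be stated in the δ-free pair form or the
η-branch value form. [folklore] -/
theorem cccOneLawText_at_three :
    ∀ (W : WeierstrassCurve ℚ) [W.IsElliptic] [W.IsGloballyMinimal] [Fact (Nat.Prime 3)],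
      X12.O10.HasSignedLocalType W 3 (.Istar 0) → W.analyticRank = 1 →
        QuadraticBranchPAdicGrossZagierValuationAt W 3 :=
  fun W _ _ _ _ _ => quadraticBranchPAdicGrossZagierValuationAt_three W

/-- The same vacuity for the route's aside `PAdicGrossZagierBranch` (item 19116, the typed law at offset
`δ = 0` quantified over all pairs): its restriction to the primes `p < 5` holds trivially. [folklore] -/
theorem pAdicGrossZagierBranch_of_lt_five (W : WeierstrassCurve ℚ) [W.IsElliptic] [W.IsGloballyMinimal]
    (p : ℕ) [Fact p.Prime] (hp : p < 5) : QuadraticBranchMinusLeadingValuationAt W p 0 :=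
  quadraticBranchMinusLeadingValuationAt_of_lt_five W p hp 0

end Summit.BirchSwinnertonDyer.BirchSwinnertonDyer.Theorems.InertBadAtThreeTypedLaw
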